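/-
Copyright (c) 2026 the pub-hodgecm-mathlib formalisation cell (harness21).  Prover seat hodgecm-mathlib-LH4-p13 (g7), req620 Track A «(D-RAM) FOUR-FRAME» squad, tier 0,
STAGE-1b PRE-SCOPING (heir LEAD F0P3a-plan (g20) T19-24 «allowed as scoping»): organ (L-lab) «THE LABEL LAW» of the rows `stub_rows_transvPlus ∕ stub_rows_transvMinus`
— brick (L-lab-2) «THE FUNCTIONAL IMAGE OF A LATTICE IS PRINCIPAL»: the hypothesis `hgen` of ★ (L-lab-1)'s one-slot label law holds at EVERY lattice `latt A`.  2026-09-04.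
-/
import Literature.NumberTheory.Automorphic.UnitaryLatticeTreeDual      -- ★ (B-p14): `mulVec_mem_latt`; brings ★ `latt`, `pairing`, `stdLattice`, `mem_stdLattice`
import Summits.HodgeConjecture.HodgeConjecture.Theorems.F0P3cDyRamFrameEltOneSlotLabel   -- ★ p858774 (this seat, (L-lab-1)): `latticeLabelPlus_frameElt_sub_one_iff_labelPlus_smul` (+ `_of_fst_small`)
import Mathlib.LinearAlgebra.Pi                                         -- `LinearMap.pi_apply_eq_sum_univ`
import HarnessLib

/-!
# Crux `H413`, line LH4 «(D-RAM) FOUR-FRAME», tier 0, STAGE-1b pre-scoping — (L-lab-2): the image of a lattice under a hermitian functional is a PRINCIPAL fractional ideal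

Cell `hodgecm-mathlib` (D-0151), FLOOR 0, crux item H413 = `stmt-HodgeConjecture-24833`, route of record `HCCMUnconditional`; squad F0∕P3c∕LH4.  SCOPING INVENTORY for the
LEAD's PLAN-T1 v19 (L-lab) paragraph; THEOREMS ONLY (no `def`, no instance, no notation, no `sorry`, default heartbeats), ★∕Mathlib-only imports, lane
`--supports stmt-HodgeConjecture-24833 --as helper`; pays NO row, states NO law.

THE MATHEMATICS.  `K` a field with `Valued K ℤᵐ⁰`, `𝒪 = 𝒪[K]`, `σ : K →+* K`, `H` any `3 × 3` matrix, `⟨x, y⟩ = pairing σ H x y` (linear in `y`), `A` any `3 × 3` matrix and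
`latt A = A·𝒪³` (★).  For a vector `v` the FUNCTIONAL IMAGE `{⟨v, y⟩ | y ∈ latt A} ⊆ K` is the `𝒪`-span of the three column values `w_i = ⟨v, A e_i⟩`; in the
ultrametric world a finitely generated `𝒪`-submodule of `K` is generated by any element of LARGEST valuation, so the image is `s⋆·𝒪` with `s⋆ = w_{i₀}`, `|w_{i₀}| = max_i |w_i|`.
* §1 **`exists_principal_functional_image`**: `∃ s⋆, ∀ z, (∃ y ∈ latt A, ⟨v, y⟩ = z) ↔ ∃ r, |r| ≤ 1 ∧ z = s⋆·r` — EXACTLY the hypothesis `hgen` of ★ (L-lab-1)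
  `F0P3cDyRamFrameEltOneSlotLabel.setOf_slot_eq_valueSetMod_smul_xPlus ∕ latticeLabelPlus_frameElt_sub_one_iff_labelPlus_smul` (there `H = Φ₃`, `v = f b 0` or `f b 1`,
  `latt A` = the vertex `M`), which is therefore AUTOMATIC at every vertex: the one-slot label law needs only the negligibility of the other slot.
* §2 `v_pairing_le_of_mem_latt` ∕ `exists_mem_latt_pairing_eq`: the generator is attained and bounds every value (`|⟨v, y⟩| ≤ |s⋆|` on `latt A`), i.e. `|s⋆| = max_i |⟨v, A e_i⟩|`
  is the functional's norm on the vertex — the letter in which the directive will state «slot `i` is `ϖ^m`-negligible at `M`» (`|(α_i − 1)·N_i⁻¹|·|s⋆_i|² ≤ |ϖ^m|`);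
  `slot_small_of_generator_small`: that ONE inequality gives ★ (L-lab-1)'s hypothesis `hsmall` on the whole lattice.
* §3 **`exists_generator_latticeLabelPlus_frameElt_iff`** (+ mirror `…_of_fst_small`): THE ONE-SLOT LABEL LAW AT A VERTEX `latt A` WITH `hgen` DISCHARGED — if the second slot's
  generator `s⋆₁` is `ϖ^m`-small (`|(ϖ^m)⁻¹·(β−1)·N₁⁻¹·N(s⋆₁)| ≤ 1`), then for the first slot's generator `s⋆₀` (which exists by §1) and EVERY scalar `e` with
  `e·t₊ = (α−1)·N₀⁻¹·N(s⋆₀)`: `LatticeLabelPlus σ ϖ d m (latt A) (γ_b − 1) ⟺ LabelPlus σ ϖ d m (e • xPlus σ ϖ d)`.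
HONEST LABEL.  Count-neutral scoping brick; the three tier-0 rows stay OPEN; `HC_CM` is proved only modulo the 7 printed citations (2 remaining named inputs: hLiu418 =
`stmt-HodgeConjecture-24832`, h413 = `stmt-HodgeConjecture-24833`) until rung 0 closes.

## References
* [Serre1979] J.-P. Serre, *Local Fields*, GTM 67 (1979), Ch. I §1 (discrete valuation rings: fractional ideals are principal, generated by an element of least valuation).
* [Kottwitz1986BaseChangeUnits] R. E. Kottwitz, *Base change for unit elements of Hecke algebras*, Compositio Math. 60 (1986), §1 pp. 240–241 (fixed points of an elliptic element on the building).
* [Rogawski1990] J. D. Rogawski, *Automorphic Representations of Unitary Groups in Three Variables*, Ann. of Math. Stud. 123 (1990), §4.9 Prop. 4.9.1 (b) p. 55.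
-/

set_option autoImplicit false

noncomputable section

namespace Summit.HodgeConjecture.HodgeConjecture.Cruxes.H413.F0P3cDyRamLatticeFunctionalImage

open Literature.NumberTheory.Automorphic Literature.NumberTheory.Automorphic.HermitianLattice
open Literature.NumberTheory.Automorphic.UnitaryLatticeTree
open scoped Matrix Valued WithZero

variable {K : Type} [Field K] [Valued K ℤᵐ⁰]

/-! ## §1  The functional image of a lattice is principal -/

/-- **THE FUNCTIONAL IMAGE OF A LATTICE IS A PRINCIPAL FRACTIONAL IDEAL.**  For any `σ`, any matrix `H` (the form), any vector `v` and any matrix `A`, there is `s⋆ ∈ K` with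
`{⟨v, y⟩_H | y ∈ latt A} = s⋆·𝒪`, i.e. `∀ z, (∃ y ∈ latt A, ⟨v, y⟩ = z) ↔ ∃ r, |r| ≤ 1 ∧ z = s⋆·r` (`s⋆ = ⟨v, A e_{i₀}⟩` a column value of largest valuation; ultrametric
inequality).  This is the hypothesis `hgen` of ★ (L-lab-1)'s one-slot label law, at every vertex. [cite: Serre1979, Ch. I §1] [cite: Kottwitz1986BaseChangeUnits, §1 pp. 240–241] -/
theorem exists_principal_functional_image (σ : K →+* K) (H : Matrix (Fin 3) (Fin 3) K) (v : Fin 3 → K) (A : Matrix (Fin 3) (Fin 3) K) :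
    ∃ sStar : K, ∀ z : K, (∃ y ∈ latt A, pairing σ H v y = z) ↔ ∃ r : K, Valued.v r ≤ 1 ∧ z = sStar * r := by
  classical
  -- the functional `L x = ⟨v, A x⟩` and the coordinate vectors `e i`
  set L : (Fin 3 → K) →ₗ[K] K := (pairing σ H v).comp (Matrix.toLin' A) with hLdef
  have hL : ∀ x, L x = pairing σ H v (A *ᵥ x) := fun x => by
    simp only [hLdef, LinearMap.comp_apply, Matrix.toLin'_apply]
  set e : Fin 3 → (Fin 3 → K) := fun i j => if i = j then (1 : K) else 0 with hedef
  have hsum : ∀ x : Fin 3 → K, L x = ∑ i, x i • L (e i) := fun x => LinearMap.pi_apply_eq_sum_univ L x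
  -- a column value of largest valuation generates
  obtain ⟨i₀, -, hi₀⟩ := Finset.exists_max_image Finset.univ (fun i => Valued.v (L (e i))) Finset.univ_nonempty
  refine ⟨L (e i₀), fun z => ⟨?_, ?_⟩⟩
  · rintro ⟨y, hy, rfl⟩
    obtain ⟨x, hx, rfl⟩ := Submodule.mem_map.1 hy
    rw [LinearMap.restrictScalars_apply, Matrix.toLin'_apply, ← hL, hsum]
    have hxi : ∀ i, Valued.v (x i) ≤ 1 := mem_stdLattice.1 hx
    -- `|Σ xᵢ L(eᵢ)| ≤ |L(e_{i₀})|`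
    have hbound : Valued.v (∑ i, x i • L (e i)) ≤ Valued.v (L (e i₀)) := by
      refine Valuation.map_sum_le _ fun i _ => ?_
      rw [smul_eq_mul, map_mul]
      exact mul_le_of_le_one_of_le (hxi i) (hi₀ i (Finset.mem_univ i))
    by_cases h0 : L (e i₀) = 0
    · refine ⟨0, by rw [map_zero]; exact zero_le_one, ?_⟩
      rw [h0, map_zero, le_zero_iff, Valuation.zero_iff] at hbound
      rw [hbound, h0, zero_mul]
    · refine ⟨(∑ i, x i • L (e i)) / L (e i₀), ?_, (mul_div_cancel₀ _ h0).symm⟩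
      rw [map_div₀]
      exact (div_le_one₀ ((Valuation.pos_iff _).2 h0)).2 hbound
  · rintro ⟨r, hr, rfl⟩
    refine ⟨A *ᵥ (r • e i₀), mulVec_mem_latt A (mem_stdLattice.2 fun j => ?_), ?_⟩
    · simp only [hedef, Pi.smul_apply, smul_eq_mul, mul_ite, mul_one, mul_zero]
      split_ifs
      · exact hr
      · rw [map_zero]; exact zero_le_one
    · rw [← hL, map_smul, smul_eq_mul, mul_comm]

/-! ## §2  The generator is attained and bounds every value -/

/-- **THE GENERATOR BOUNDS THE FUNCTIONAL ON THE LATTICE**: with `s⋆` as in §1, `|⟨v, y⟩| ≤ |s⋆|` for every `y ∈ latt A`. [cite: Serre1979, Ch. I §1] -/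
theorem v_pairing_le_of_generator (σ : K →+* K) (H : Matrix (Fin 3) (Fin 3) K) (v : Fin 3 → K) (A : Matrix (Fin 3) (Fin 3) K) {sStar : K}
    (hgen : ∀ z : K, (∃ y ∈ latt A, pairing σ H v y = z) ↔ ∃ r : K, Valued.v r ≤ 1 ∧ z = sStar * r)
    {y : Fin 3 → K} (hy : y ∈ latt A) : Valued.v (pairing σ H v y) ≤ Valued.v sStar := by
  obtain ⟨r, hr, hyr⟩ := (hgen _).1 ⟨y, hy, rfl⟩
  rw [hyr, map_mul]
  exact mul_le_of_le_one_right' hr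

/-- **THE GENERATOR IS ATTAINED**: with `s⋆` as in §1, `s⋆ = ⟨v, y⋆⟩` for some `y⋆ ∈ latt A`. [cite: Serre1979, Ch. I §1] -/
theorem exists_mem_latt_pairing_eq_generator (σ : K →+* K) (H : Matrix (Fin 3) (Fin 3) K) (v : Fin 3 → K) (A : Matrix (Fin 3) (Fin 3) K) {sStar : K}
    (hgen : ∀ z : K, (∃ y ∈ latt A, pairing σ H v y = z) ↔ ∃ r : K, Valued.v r ≤ 1 ∧ z = sStar * r) :
    ∃ y ∈ latt A, pairing σ H v y = sStar :=
  (hgen sStar).2 ⟨1, by rw [map_one], (mul_one sStar).symm⟩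

/-- **NEGLIGIBILITY IN THE GENERATOR'S LETTER**: if `|(ϖ^m)⁻¹·c·N(s⋆)| ≤ 1` (`N(s) = s·σs`, `σ` isometric) then the slot `c·N(⟨v, y⟩)` is `ϖ^m`-negligible on the whole lattice:
`|(ϖ^m)⁻¹·(c·N(⟨v, y⟩))| ≤ 1` for all `y ∈ latt A` — the form in which ★ (L-lab-1)'s hypothesis `hsmall` is checked from ONE number. [cite: Serre1979, Ch. I §1] [cite: Rogawski1990, §4.9 Prop. 4.9.1 (b) p. 55] -/
theorem slot_small_of_generator_small {σ : K →+* K} (hvσ : ∀ a, Valued.v (σ a) = Valued.v a) (H : Matrix (Fin 3) (Fin 3) K) (v : Fin 3 → K)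
    (A : Matrix (Fin 3) (Fin 3) K) {sStar : K} (ϖ : K) (m : ℕ) (c : K)
    (hgen : ∀ z : K, (∃ y ∈ latt A, pairing σ H v y = z) ↔ ∃ r : K, Valued.v r ≤ 1 ∧ z = sStar * r)
    (hsmall : Valued.v ((ϖ ^ m)⁻¹ * (c * (sStar * σ sStar))) ≤ 1) :
    ∀ y ∈ latt A, Valued.v ((ϖ ^ m)⁻¹ * (c * (pairing σ H v y * σ (pairing σ H v y)))) ≤ 1 := by
  intro y hy
  obtain ⟨r, hr, hyr⟩ := (hgen _).1 ⟨y, hy, rfl⟩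
  have hN : Valued.v (r * σ r) ≤ 1 := by rw [map_mul, hvσ]; exact mul_le_one' hr hr
  have hrw : (ϖ ^ m)⁻¹ * (c * (pairing σ H v y * σ (pairing σ H v y))) = (ϖ ^ m)⁻¹ * (c * (sStar * σ sStar)) * (r * σ r) := by
    rw [hyr, map_mul]; ring
  rw [hrw, map_mul]
  exact mul_le_one' hsmall hN

/-! ## §3  The one-slot label law at a vertex `latt A`, with the principality hypothesis discharged -/

open Literature.NumberTheory.Automorphic.UnitaryThreeFourFrame
open Summit.HodgeConjecture.HodgeConjecture.Cruxes.H413.F0P3cDyRamFourFramePieces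
open Summit.HodgeConjecture.HodgeConjecture.Cruxes.H413.F0P3cDyRamFourFrameCensusDefs
open Summit.HodgeConjecture.HodgeConjecture.Cruxes.H413.F0P3cDyRamFrameEltOneSlotLabel
  (latticeLabelPlus_frameElt_sub_one_iff_labelPlus_smul latticeLabelPlus_frameElt_sub_one_iff_labelPlus_smul_of_fst_small)

/-- **THE ONE-SLOT LABEL LAW AT A VERTEX, FIRST SLOT DOMINANT, `hgen` DISCHARGED.**  `σ` an involutive isometry; `γ_b = frameElt σ f b α β`; `M = latt A` any lattice; `s⋆₁` a
generator of the second functional image with `|(ϖ^m)⁻¹·(β−1)·N₁⁻¹·N(s⋆₁)| ≤ 1`.  Then there is a generator `s⋆₀` of the first functional image (`{⟨f b 0, y⟩ | y ∈ M} = s⋆₀·𝒪`)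
such that for EVERY scalar `e` with `e·t₊ = (α − 1)·N₀⁻¹·N(s⋆₀)`: `LatticeLabelPlus σ ϖ d m M (γ_b − 1) ⟺ LabelPlus σ ϖ d m (e • xPlus σ ϖ d)` (§1 + ★ (L-lab-1)).
[cite: Rogawski1990, §4.9 Prop. 4.9.1 (b) p. 55] [cite: Kottwitz1986BaseChangeUnits, §1 pp. 240–241] -/
theorem exists_generator_latticeLabelPlus_frameElt_iff {σ : K →+* K} (hσσ : ∀ a, σ (σ a) = a) (hvσ : ∀ a, Valued.v (σ a) = Valued.v a) (ϖ : K) (d m : ℕ)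
    (A : Matrix (Fin 3) (Fin 3) K) (f : Fin 4 → Fin 3 → (Fin 3 → K)) (b : Fin 4) (α β : K) {sStar₁ : K}
    (hgen₁ : ∀ z : K, (∃ y ∈ latt A, pairing σ ((StdForm.antidiagonal 3).over K) (f b 1) y = z) ↔ ∃ r : K, Valued.v r ≤ 1 ∧ z = sStar₁ * r)
    (hsmall₁ : Valued.v ((ϖ ^ m)⁻¹ * ((β - 1) * ((pairing σ ((StdForm.antidiagonal 3).over K) (f b 1) (f b 1))⁻¹ * (sStar₁ * σ sStar₁)))) ≤ 1) :
    ∃ sStar₀ : K, (∀ z : K, (∃ y ∈ latt A, pairing σ ((StdForm.antidiagonal 3).over K) (f b 0) y = z) ↔ ∃ r : K, Valued.v r ≤ 1 ∧ z = sStar₀ * r) ∧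
      ∀ e : K, e * ((ϖ - σ ϖ) * ((ϖ * σ ϖ) ^ ((d - d % 2) / 2))⁻¹) =
          (α - 1) * (pairing σ ((StdForm.antidiagonal 3).over K) (f b 0) (f b 0))⁻¹ * (sStar₀ * σ sStar₀) →
        (LatticeLabelPlus σ ϖ d m (latt A) (frameElt σ f b α β - 1) ↔ LabelPlus σ ϖ d m (e • xPlus σ ϖ d)) := by
  obtain ⟨sStar₀, hgen₀⟩ := exists_principal_functional_image σ ((StdForm.antidiagonal 3).over K) (f b 0) A
  refine ⟨sStar₀, hgen₀, fun e he => ?_⟩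
  have hsmall := slot_small_of_generator_small hvσ ((StdForm.antidiagonal 3).over K) (f b 1) A ϖ m
    ((β - 1) * (pairing σ ((StdForm.antidiagonal 3).over K) (f b 1) (f b 1))⁻¹) hgen₁ (by rw [mul_assoc]; exact hsmall₁)
  exact latticeLabelPlus_frameElt_sub_one_iff_labelPlus_smul hσσ ϖ d m (latt A) f b α β
    (fun y hy => by have h := hsmall y hy; rwa [mul_assoc] at h) hgen₀ he

/-- **THE ONE-SLOT LABEL LAW AT A VERTEX, SECOND SLOT DOMINANT, `hgen` DISCHARGED** (mirror): `s⋆₀` a generator of the first functional image with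
`|(ϖ^m)⁻¹·(α−1)·N₀⁻¹·N(s⋆₀)| ≤ 1` ⇒ for a generator `s⋆₁` of the second image and every `e` with `e·t₊ = (β − 1)·N₁⁻¹·N(s⋆₁)`:
`LatticeLabelPlus σ ϖ d m (latt A) (γ_b − 1) ⟺ LabelPlus σ ϖ d m (e • xPlus σ ϖ d)`. [cite: Rogawski1990, §4.9 Prop. 4.9.1 (b) p. 55] [cite: Kottwitz1986BaseChangeUnits, §1 pp. 240–241] -/
theorem exists_generator_latticeLabelPlus_frameElt_iff_of_fst_small {σ : K →+* K} (hσσ : ∀ a, σ (σ a) = a) (hvσ : ∀ a, Valued.v (σ a) = Valued.v a)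
    (ϖ : K) (d m : ℕ) (A : Matrix (Fin 3) (Fin 3) K) (f : Fin 4 → Fin 3 → (Fin 3 → K)) (b : Fin 4) (α β : K) {sStar₀ : K}
    (hgen₀ : ∀ z : K, (∃ y ∈ latt A, pairing σ ((StdForm.antidiagonal 3).over K) (f b 0) y = z) ↔ ∃ r : K, Valued.v r ≤ 1 ∧ z = sStar₀ * r)
    (hsmall₀ : Valued.v ((ϖ ^ m)⁻¹ * ((α - 1) * ((pairing σ ((StdForm.antidiagonal 3).over K) (f b 0) (f b 0))⁻¹ * (sStar₀ * σ sStar₀)))) ≤ 1) :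
    ∃ sStar₁ : K, (∀ z : K, (∃ y ∈ latt A, pairing σ ((StdForm.antidiagonal 3).over K) (f b 1) y = z) ↔ ∃ r : K, Valued.v r ≤ 1 ∧ z = sStar₁ * r) ∧
      ∀ e : K, e * ((ϖ - σ ϖ) * ((ϖ * σ ϖ) ^ ((d - d % 2) / 2))⁻¹) =
          (β - 1) * (pairing σ ((StdForm.antidiagonal 3).over K) (f b 1) (f b 1))⁻¹ * (sStar₁ * σ sStar₁) →
        (LatticeLabelPlus σ ϖ d m (latt A) (frameElt σ f b α β - 1) ↔ LabelPlus σ ϖ d m (e • xPlus σ ϖ d)) := by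
  obtain ⟨sStar₁, hgen₁⟩ := exists_principal_functional_image σ ((StdForm.antidiagonal 3).over K) (f b 1) A
  refine ⟨sStar₁, hgen₁, fun e he => ?_⟩
  have hsmall := slot_small_of_generator_small hvσ ((StdForm.antidiagonal 3).over K) (f b 0) A ϖ m
    ((α - 1) * (pairing σ ((StdForm.antidiagonal 3).over K) (f b 0) (f b 0))⁻¹) hgen₀ (by rw [mul_assoc]; exact hsmall₀)
  exact latticeLabelPlus_frameElt_sub_one_iff_labelPlus_smul_of_fst_small hσσ ϖ d m (latt A) f b α β
    (fun y hy => by have h := hsmall y hy; rwa [mul_assoc] at h) hgen₁ he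

end Summit.HodgeConjecture.HodgeConjecture.Cruxes.H413.F0P3cDyRamLatticeFunctionalImage

end
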